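import Literature.NumberTheory.PAdicHodge.NeronDeRhamDatum
import HarnessLib

/-!
# Transport of Kato's dual exponential along a morphism of period-ring data
# (`B_dR(K) → B_dR(L)` over the restriction `Γ_L → Γ_K`): the abstract half of `exp*`-functoriality
# in the field (route `KimAtThreeKolyvagin`, rung W2; cell `bsd-addord`, seat w2-c2 gen 8)

HONEST FRAMING. Theorems and one auxiliary definition with body (the coefficient map `Φ ⊗ id`); no named
fact, no `sorry`, no instance; nothing is closed or booked; BSD is not proved by any of this.

## What, and why
The W2 residual packages display the clause (RES) / (RES_w): «`exp*` over `L_w` of the restriction of a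
class `y ∈ H¹(ℚ_v, T_pW)` is `exp*` over `ℚ_v` of `y`, read in `L_w`» (seat kim3's hKdef, the uniform
road's X1-int_b).  With `exp*_ω` DEFINED (`KimAtThreeDeepLowerExpStarOmega`, p500247) this is a THEOREM,
in two halves: (i) ABSTRACT (this file) — Kato's relation `IsDualExpOf` (LNM 1553 II.1.2.4) is transported
along any ring homomorphism `Φ : B → B'` of period-ring data over a group homomorphism `s : Γ' → Γ` which is
equivariant (`Φ (s τ • b) = τ • Φ b`), compatible with the coefficient fields (`Φ ∘ (E → B) = (E' → B') ∘ (E → E')`)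
and with `Fil⁰`; hence, under the Prop-1.2.3 binders, `exp*' (z ∘ s) = (Φ ⊗ id)(exp* z)` and the scalar
coordinates satisfy `exp*'_{(Φ⊗id)ω}(z ∘ s) = (E → E')(exp*_ω z)`; (ii) CONCRETE (sequel
`KimAtThreeDeepLowerExpStarOmegaRes`) — the tree's filtered equivariant isomorphism `Φ : B_dR(K) ≃ B_dR(L)`
(`BdRBaseChangeFiltered.exists_fracBdR_ringEquiv_filtered`) for a continuous embedding `K → L` of `p`-adic fields.

## Contents (abstract: `𝔅 : PeriodRingData Γ P E`, `𝔅' : PeriodRingData Γ' P E'`, `[Algebra E E']`,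
## `[IsScalarTower P E E']`, `s : Γ' →ₜ* Γ`, `Φ : 𝔅.B →+* 𝔅'.B` with the three compatibilities)
* `coeffMap Φ hΦE : 𝔅.B ⊗[P] M →ₗ[P] 𝔅'.B ⊗[P] M` (`= Φ ⊗ id`), `coeffMap_tmul`, `coeffMap_smul_algebraMap`
  (`E`-semilinearity), `coeffMap_tensorRep` (equivariance over `s`), `coeffMap_mem_filTensor`, `coeffMap_mem_D`,
  `coeffMap_injective` (for injective `Φ`; modules over the field `P` are flat);
* `IsFilZeroCoboundary.transport`, `IsDualExpOf.transport`, `HasDualExp.transport` (with `ψ' = ψ ∘ s`);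
* `dualExp_transport` : `𝔅'.dualExp ψ' (ρ.restrict s) (z ∘ s) = coeffMap (𝔅.dualExp ψ ρ z)` (under
  `CupLogInjective` on both sides and `HasDualExp z`); `dualExpCoord_transport`;
* `FilZeroLine.transport` — the generator `(Φ ⊗ id) ω` of `Fil⁰ D'` (given that `Fil⁰ D'` is a line, i.e. some
  generator exists over `𝔅'`), and `dualExpCoord_filZeroLine_transport`.

References: K. Kato, LNM 1553 (1993), Ch. II §1.2.4, Prop. 1.2.3 [Kato1993LNM1553]; O. Brinon, B. Conrad,
*CMI notes on p-adic Hodge theory* (2009), Prop. 6.3.8 (`K' ⊗_K D_{dR,K}(V) ≅ D_{dR,K'}(V)`) [BrinonConrad2009];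
J.-M. Fontaine, Astérisque 223 (1994), Exp. III §1.5 [FontaineAsterisque223III].
-/

set_option autoImplicit false
-- the Theorems namespace of a single-conjunct summit repeats the summit name by design (D-0017)
set_option linter.dupNamespace false

noncomputable section

open scoped TensorProduct
open TensorProduct Function
open Literature.NumberTheory.GaloisRepresentations
open Literature.NumberTheory.GaloisRepresentations.PeriodRingData

namespace Summit.BirchSwinnertonDyer.BirchSwinnertonDyer.Theorems.KimAtThreeDeepLowerExpStarOmegaTransport

universe u v v' w w'

section Transport

variable {Γ Γ' : Type u} [Group Γ] [TopologicalSpace Γ] [Group Γ'] [TopologicalSpace Γ']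
  {P : Type v} [Field P] [TopologicalSpace P]
  {E E' : Type v'} [Field E] [Field E'] [Algebra P E] [Algebra P E'] [Algebra E E'] [IsScalarTower P E E']
  {M : Type w'} [AddCommGroup M] [Module P M] [TopologicalSpace M]
  {𝔅 : PeriodRingData.{u, v, v', w} Γ P E} {𝔅' : PeriodRingData.{u, v, v', w} Γ' P E'}
  (s : Γ' →ₜ* Γ) (ρ : ContinuousRep Γ P M)
  (Φ : 𝔅.B →+* 𝔅'.B)
  (hΦE : ∀ e : E, Φ (algebraMap E 𝔅.B e) = algebraMap E' 𝔅'.B (algebraMap E E' e))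

include hΦE

omit [TopologicalSpace Γ] [TopologicalSpace Γ'] [TopologicalSpace P] in
/-- A ring homomorphism of period rings compatible with the coefficient fields is `P`-linear. [folklore] -/
theorem map_algebraMap_P (c : P) : Φ (algebraMap P 𝔅.B c) = algebraMap P 𝔅'.B c := by
  rw [PeriodRingData.algebraMap_eq, hΦE, ← IsScalarTower.algebraMap_apply P E E',
    ← PeriodRingData.algebraMap_eq]

/-- `Φ` as a `P`-linear map. [folklore] -/
def linearMapP : 𝔅.B →ₗ[P] 𝔅'.B where
  toFun := Φ
  map_add' := Φ.map_add
  map_smul' c b := by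
    rw [Algebra.smul_def, map_mul, map_algebraMap_P Φ hΦE, ← Algebra.smul_def, RingHom.id_apply]

omit [TopologicalSpace Γ] [TopologicalSpace Γ'] [TopologicalSpace P] in
/-- Unfolding `linearMapP`. [folklore] -/
@[simp] theorem linearMapP_apply (b : 𝔅.B) : linearMapP Φ hΦE b = Φ b := rfl

variable (M) in
/-- **The coefficient map `Φ ⊗ id : B ⊗ V → B' ⊗ V`.** [folklore] -/
def coeffMap : 𝔅.B ⊗[P] M →ₗ[P] 𝔅'.B ⊗[P] M :=
  (linearMapP Φ hΦE).rTensor M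

omit [TopologicalSpace Γ] [TopologicalSpace Γ'] [TopologicalSpace P] [TopologicalSpace M] in
/-- `(Φ ⊗ id)(b ⊗ m) = Φ b ⊗ m`. [folklore] -/
@[simp] theorem coeffMap_tmul (b : 𝔅.B) (m : M) : coeffMap M Φ hΦE (b ⊗ₜ[P] m) = Φ b ⊗ₜ[P] m := rfl

omit [TopologicalSpace Γ] [TopologicalSpace Γ'] [TopologicalSpace P] [TopologicalSpace M] in
/-- `Φ ⊗ id` is `E`-semilinear along `E → E'`. [folklore] -/
theorem coeffMap_smul_algebraMap (e : E) (x : 𝔅.B ⊗[P] M) :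
    coeffMap M Φ hΦE (e • x) = algebraMap E E' e • coeffMap M Φ hΦE x := by
  induction x using TensorProduct.induction_on with
  | zero => simp only [smul_zero, map_zero]
  | tmul b m =>
    rw [TensorProduct.smul_tmul', coeffMap_tmul, coeffMap_tmul, TensorProduct.smul_tmul',
      Algebra.smul_def, map_mul, hΦE, ← Algebra.smul_def]
  | add x y hx hy => simp only [smul_add, map_add, hx, hy]

/-- **`Φ ⊗ id` is equivariant over `s`**: `(Φ ⊗ id)((s τ) · x) = τ · (Φ ⊗ id) x` for the diagonal actions,
when `Φ (s τ • b) = τ • Φ b`. [folklore] -/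
theorem coeffMap_tensorRep (hΦs : ∀ (τ : Γ') (b : 𝔅.B), Φ (s τ • b) = τ • Φ b) (τ : Γ')
    (x : 𝔅.B ⊗[P] M) :
    coeffMap M Φ hΦE (𝔅.tensorRep ρ (s τ) x) = 𝔅'.tensorRep (ρ.restrict s) τ (coeffMap M Φ hΦE x) := by
  induction x using TensorProduct.induction_on with
  | zero => simp only [map_zero]
  | tmul b m =>
    rw [tensorRep_apply_tmul, coeffMap_tmul, coeffMap_tmul, tensorRep_apply_tmul, hΦs,
      ContinuousRep.restrict_apply]
  | add x y hx hy => simp only [map_add, hx, hy]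

omit [TopologicalSpace Γ] [TopologicalSpace Γ'] [TopologicalSpace P] [TopologicalSpace M] in
/-- `Φ ⊗ id` maps `Fil^i B ⊗ V` into `Fil^i B' ⊗ V` when `Φ(Fil^i B) ⊆ Fil^i B'`. [folklore] -/
theorem coeffMap_mem_filTensor {i : ℤ} (hΦfil : ∀ b, b ∈ 𝔅.fil i → Φ b ∈ 𝔅'.fil i)
    {x : 𝔅.B ⊗[P] M} (hx : x ∈ 𝔅.filTensor M i) : coeffMap M Φ hΦE x ∈ 𝔅'.filTensor M i := by
  obtain ⟨y, rfl⟩ := hx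
  induction y using TensorProduct.induction_on with
  | zero => simp only [map_zero]; exact Submodule.zero_mem _
  | tmul f m =>
    refine ⟨(⟨Φ f, hΦfil f f.2⟩ : 𝔅'.fil i) ⊗ₜ[P] m, ?_⟩
    rfl
  | add y y' hy hy' => rw [map_add, map_add]; exact Submodule.add_mem _ hy hy'

/-- `Φ ⊗ id` maps `D(V) = (B ⊗ V)^Γ` into `D'(V|_{Γ'}) = (B' ⊗ V)^{Γ'}`. [folklore] -/
theorem coeffMap_mem_D (hΦs : ∀ (τ : Γ') (b : 𝔅.B), Φ (s τ • b) = τ • Φ b) {x : 𝔅.B ⊗[P] M}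
    (hx : x ∈ 𝔅.D ρ) : coeffMap M Φ hΦE x ∈ 𝔅'.D (ρ.restrict s) := fun τ => by
  rw [← coeffMap_tensorRep s ρ Φ hΦE hΦs, hx (s τ)]

omit [TopologicalSpace Γ] [TopologicalSpace Γ'] [TopologicalSpace P] [TopologicalSpace M] in
/-- `Φ ⊗ id` is injective when `Φ` is (every `P`-module is flat, `P` a field). [folklore] -/
theorem coeffMap_injective (hΦ : Injective Φ) : Injective (coeffMap M Φ hΦE) :=
  Module.Flat.rTensor_preserves_injective_linearMap (linearMapP Φ hΦE) hΦ

/-- A `Fil⁰`-coboundary over `Γ` maps to a `Fil⁰`-coboundary over `Γ'`. [cite: Kato1993LNM1553, Ch. II §1.2.4] -/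
theorem isFilZeroCoboundary_transport (hΦs : ∀ (τ : Γ') (b : 𝔅.B), Φ (s τ • b) = τ • Φ b)
    (hΦfil : ∀ b, b ∈ 𝔅.fil 0 → Φ b ∈ 𝔅'.fil 0) {c : Γ → 𝔅.B ⊗[P] M}
    (hc : 𝔅.IsFilZeroCoboundary ρ c) :
    𝔅'.IsFilZeroCoboundary (ρ.restrict s) fun τ => coeffMap M Φ hΦE (c (s τ)) := by
  obtain ⟨b, hb, h⟩ := hc
  exact ⟨coeffMap M Φ hΦE b, coeffMap_mem_filTensor Φ hΦE hΦfil hb, fun τ => by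
    show coeffMap M Φ hΦE (c (s τ)) = _
    rw [h, map_sub, coeffMap_tensorRep s ρ Φ hΦE hΦs]⟩

/-- **Transport of Kato's relation**: if `x` is a dual exponential of `z : Γ → V` (for `ψ`), then
`(Φ ⊗ id) x` is a dual exponential of `z ∘ s : Γ' → V` (for `ψ ∘ s`). [cite: Kato1993LNM1553, Ch. II §1.2.4] -/
theorem isDualExpOf_transport (hΦs : ∀ (τ : Γ') (b : 𝔅.B), Φ (s τ • b) = τ • Φ b)
    (hΦfil : ∀ b, b ∈ 𝔅.fil 0 → Φ b ∈ 𝔅'.fil 0) {ψ : Γ → P} {ψ' : Γ' → P} (hψ : ∀ τ, ψ' τ = ψ (s τ))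
    {z : Γ → M} {x : 𝔅.B ⊗[P] M} (h : 𝔅.IsDualExpOf ψ ρ z x) :
    𝔅'.IsDualExpOf ψ' (ρ.restrict s) (fun τ => z (s τ)) (coeffMap M Φ hΦE x) := by
  refine ⟨coeffMap_mem_D s ρ Φ hΦE hΦs h.1, coeffMap_mem_filTensor Φ hΦE hΦfil h.2.1,
    (isFilZeroCoboundary_transport s ρ Φ hΦE hΦs hΦfil h.2.2).congr fun τ => ?_⟩
  show coeffMap M Φ hΦE ((1 : 𝔅.B) ⊗ₜ[P] z (s τ) - algebraMap P E (ψ (s τ)) • x) = _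
  rw [map_sub, coeffMap_tmul, map_one, coeffMap_smul_algebraMap, ← IsScalarTower.algebraMap_apply P E E',
    ← hψ]

/-- Existence of a dual exponential is transported. [cite: Kato1993LNM1553, Ch. II Prop. 1.2.3] -/
theorem hasDualExp_transport (hΦs : ∀ (τ : Γ') (b : 𝔅.B), Φ (s τ • b) = τ • Φ b)
    (hΦfil : ∀ b, b ∈ 𝔅.fil 0 → Φ b ∈ 𝔅'.fil 0) {ψ : Γ → P} {ψ' : Γ' → P} (hψ : ∀ τ, ψ' τ = ψ (s τ))
    {z : Γ → M} (h : 𝔅.HasDualExp ψ ρ z) : 𝔅'.HasDualExp ψ' (ρ.restrict s) fun τ => z (s τ) := by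
  obtain ⟨x, hx⟩ := h
  exact ⟨coeffMap M Φ hΦE x, isDualExpOf_transport s ρ Φ hΦE hΦs hΦfil hψ hx⟩

/-- **`exp*` commutes with restriction along `Φ`**: `exp*'(z ∘ s) = (Φ ⊗ id)(exp* z)`, under injectivity of
the cup product on both sides and existence for `z` (Kato Prop. 1.2.3). [cite: Kato1993LNM1553, Ch. II §1.2.4 and Prop. 1.2.3] -/
theorem dualExp_transport (hΦs : ∀ (τ : Γ') (b : 𝔅.B), Φ (s τ • b) = τ • Φ b)
    (hΦfil : ∀ b, b ∈ 𝔅.fil 0 → Φ b ∈ 𝔅'.fil 0) {ψ : Γ → P} {ψ' : Γ' → P} (hψ : ∀ τ, ψ' τ = ψ (s τ))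
    (hinj : 𝔅.CupLogInjective ψ ρ) (hinj' : 𝔅'.CupLogInjective ψ' (ρ.restrict s))
    {z : Γ → M} (hz : 𝔅.HasDualExp ψ ρ z) :
    𝔅'.dualExp ψ' (ρ.restrict s) (fun τ => z (s τ)) = coeffMap M Φ hΦE (𝔅.dualExp ψ ρ z) :=
  dualExp_spec hinj' (isDualExpOf_transport s ρ Φ hΦE hΦs hΦfil hψ (isDualExpOf_dualExp hinj hz))

/-- **The scalar coordinate commutes with restriction**: along a vector `ω` with `exp* z ∈ E ω` (e.g. a generator
of the line `Fil⁰ D`) whose image `(Φ ⊗ id) ω` is nonzero,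
`exp*'_{(Φ⊗id)ω}(z ∘ s) = (E → E')(exp*_ω z)`. [cite: Kato1993LNM1553, Ch. II §1.2.4 and Prop. 1.2.3] -/
theorem dualExpCoord_transport (hΦs : ∀ (τ : Γ') (b : 𝔅.B), Φ (s τ • b) = τ • Φ b)
    (hΦfil : ∀ b, b ∈ 𝔅.fil 0 → Φ b ∈ 𝔅'.fil 0) {ψ : Γ → P} {ψ' : Γ' → P} (hψ : ∀ τ, ψ' τ = ψ (s τ))
    (hinj : 𝔅.CupLogInjective ψ ρ) (hinj' : 𝔅'.CupLogInjective ψ' (ρ.restrict s))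
    {ω : 𝔅.B ⊗[P] M} (hω : ω ≠ 0) (hline : ∀ x ∈ 𝔅.D ρ, x ∈ 𝔅.filTensor M 0 → ∃ e : E, x = e • ω)
    (hω' : coeffMap M Φ hΦE ω ≠ 0) {z : Γ → M} (hz : 𝔅.HasDualExp ψ ρ z) :
    𝔅'.dualExpCoord ψ' (ρ.restrict s) (coeffMap M Φ hΦE ω) (fun τ => z (s τ)) =
      algebraMap E E' (𝔅.dualExpCoord ψ ρ ω z) :=
  dualExpCoord_eq hω' (by
    rw [dualExp_transport s ρ Φ hΦE hΦs hΦfil hψ hinj hinj' hz, dualExp_eq_dualExpCoord_smul hω hline z,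
      coeffMap_smul_algebraMap])

/-! #### Transport of a generator of the line `Fil⁰ D` -/

/-- **Transport of a generator of `Fil⁰ D(V)` to a generator of `Fil⁰ D'(V|_{Γ'})`**, along an equivariant,
`Fil⁰`-compatible, injective `Φ`, GIVEN that `Fil⁰ D'` is itself a line (some generator `d₀'` exists — for
`B_dR` this is the dimension statement `dim D⁰_dR = 1` over the larger field): the vector `(Φ ⊗ id) ω` is
invariant, of filtration `≥ 0`, nonzero, hence spans the line. (Brinon–Conrad Prop. 6.3.8 is the statement
that `Φ ⊗ id` induces `E' ⊗_E D_K ≅ D_{K'}` in general; only the rank-one case is used here.)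
[cite: BrinonConrad2009, Prop. 6.3.8] [cite: Kato1993LNM1553, Ch. II Ex. 1.3.5] -/
def filZeroLineTransport (hΦs : ∀ (τ : Γ') (b : 𝔅.B), Φ (s τ • b) = τ • Φ b)
    (hΦfil : ∀ b, b ∈ 𝔅.fil 0 → Φ b ∈ 𝔅'.fil 0) (hΦ : Injective Φ)
    (d : 𝔅.FilZeroLine ρ) (d₀' : 𝔅'.FilZeroLine (ρ.restrict s)) : 𝔅'.FilZeroLine (ρ.restrict s) where
  ω := coeffMap M Φ hΦE d.ω
  mem_D := coeffMap_mem_D s ρ Φ hΦE hΦs d.mem_D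
  mem_filTensor := coeffMap_mem_filTensor Φ hΦE hΦfil d.mem_filTensor
  ne_zero h := d.ne_zero (coeffMap_injective Φ hΦE hΦ (by rw [h, map_zero]))
  exists_smul_eq x hx hfil := by
    obtain ⟨e, he⟩ := d₀'.exists_smul_eq _ (coeffMap_mem_D s ρ Φ hΦE hΦs d.mem_D)
      (coeffMap_mem_filTensor Φ hΦE hΦfil d.mem_filTensor)
    have he0 : e ≠ 0 := by
      rintro rfl
      rw [zero_smul] at he
      exact d.ne_zero (coeffMap_injective Φ hΦE hΦ (by rw [he, map_zero]))
    obtain ⟨c, hc⟩ := d₀'.exists_smul_eq x hx hfil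
    exact ⟨c * e⁻¹, by rw [mul_smul, he, smul_smul e⁻¹, inv_mul_cancel₀ he0, one_smul, hc]⟩

/-- The transported generator is `(Φ ⊗ id) ω`. [folklore] -/
@[simp] theorem filZeroLineTransport_ω (hΦs : ∀ (τ : Γ') (b : 𝔅.B), Φ (s τ • b) = τ • Φ b)
    (hΦfil : ∀ b, b ∈ 𝔅.fil 0 → Φ b ∈ 𝔅'.fil 0) (hΦ : Injective Φ)
    (d : 𝔅.FilZeroLine ρ) (d₀' : 𝔅'.FilZeroLine (ρ.restrict s)) :
    (filZeroLineTransport s ρ Φ hΦE hΦs hΦfil hΦ d d₀').ω = coeffMap M Φ hΦE d.ω := rfl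

/-- **`exp*_ω` commutes with restriction** along the transported generator:
`exp*'_{(Φ⊗id)ω}(z ∘ s) = (E → E')(exp*_ω z)` (under the Prop-1.2.3 binders on both sides and existence for `z`).
[cite: Kato1993LNM1553, Ch. II §1.2.4 and Prop. 1.2.3] -/
theorem dualExpCoord_filZeroLineTransport (hΦs : ∀ (τ : Γ') (b : 𝔅.B), Φ (s τ • b) = τ • Φ b)
    (hΦfil : ∀ b, b ∈ 𝔅.fil 0 → Φ b ∈ 𝔅'.fil 0) (hΦ : Injective Φ)
    (d : 𝔅.FilZeroLine ρ) (d₀' : 𝔅'.FilZeroLine (ρ.restrict s))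
    {ψ : Γ → P} {ψ' : Γ' → P} (hψ : ∀ τ, ψ' τ = ψ (s τ))
    (hinj : 𝔅.CupLogInjective ψ ρ) (hinj' : 𝔅'.CupLogInjective ψ' (ρ.restrict s))
    {z : Γ → M} (hz : 𝔅.HasDualExp ψ ρ z) :
    𝔅'.dualExpCoord ψ' (ρ.restrict s) (filZeroLineTransport s ρ Φ hΦE hΦs hΦfil hΦ d d₀').ω
        (fun τ => z (s τ)) = algebraMap E E' (𝔅.dualExpCoord ψ ρ d.ω z) :=
  dualExpCoord_transport s ρ Φ hΦE hΦs hΦfil hψ hinj hinj' d.ne_zero d.exists_smul_eq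
    (filZeroLineTransport s ρ Φ hΦE hΦs hΦfil hΦ d d₀').ne_zero hz

end Transport

end Summit.BirchSwinnertonDyer.BirchSwinnertonDyer.Theorems.KimAtThreeDeepLowerExpStarOmegaTransport

end
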